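import Literature.NumberTheory.EllipticCurves.ZpExtensionPadicLogProofs
import Mathlib.Topology.Algebra.ContinuousMonoidHom
import HarnessLib

/-!
# X11b · S29 K3 (T3, algebraic half): continuous characters `ℤ_pˣ → ℤ_p` become INTEGER powers
# after a `γ`-adic exponential twist (every prime `p`; theorems only)

HONEST FRAMING (cell `b2b-bsdres`, run/shared/lean/b2b/bsd-rank1-residual/, verbatim in every
file): the goal of the cell is to DELETE the COMBINATION-SHAPED residual classes of the
Birch–Swinnerton-Dyer formula for ALL analytic-rank `≤ 1` elliptic curves over `ℚ` — assembled
STRICTLY from published theorems — so that the rank-`≤ 1` remainder becomes exactly the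
CONSTRUCTION-SHAPED classes, which are TYPED, NOT attempted. This is not "finishing BSD". Team
`x11b3` = N8/O2 (X11b at `p = 3`): research routes; nothing booked; no label change; O2 OPEN; the
node of record `Three.HsiehDescentAt₃` is UNCHANGED by this file (sub-target S29 RE-EXPRESSES (t)
⟸ (VR); lead GEN 8 R9-8 / R9-25 / R9-30).

PROVENANCE: S29 kernel package K3 = [T2 T3 T4 T5], item (T3) of x11b3-p7's `hSen` (r2's (T′),
`HOME/b2b-bsdres-x11b3-r2/gen12/S29-0c-QK2b-r2.md` §5), seat `b2b-bsdres-x11b3-p1` GEN 3. This is the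
`ℤ_p`-ALGEBRA that turns "a ramified exponent character" into "an integer power of the cyclotomic
character": for the `γ`-adic exponential `e : ℤ_p → ℤ_p`, `e(x) = γˣ`, `γ = 1 + p³` (a continuous
additive character with `e 1 = 1 + p³`; Mathlib `PadicInt.addChar_of_value_at_one`, tree
`ZpExtension.PadicUnits.exists_continuous_addChar`) and a continuous `f : ℤ_pˣ →ₜ* ℤ_p`,

* `toAdd_apply_expUnits_eq_mul` — **`f ∘ e` is `ℤ_p`-linear**: `f(e(x)) = c·x` with `c = f(γ)`
  (additive + continuous on `ℤ_p` ⇒ linear, by density of `ℕ`);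
* `apply_expUnits_one_ne_one` — if `f ≠ 1` then `c = f(γ) ≠ 0` (`u^N ∈ 1 + p³ℤ_p = e(ℤ_p)` for
  `N = (p-1)p²`, and `ℤ_p` is torsion-free);
* **`exists_exp_mul_apply_eq_pow`** — for every `i` there are `s ∈ p^i ℤ_p ∖ {0}` and `j ≥ 1` with
  `e(s · f(u)) = u ^ j` for ALL `u ∈ ℤ_pˣ` (take `s = N p^i c₀⁻¹`, `j = N p^{i+v}` where `c = c₀ p^v`):
  the exponent character `u ↦ γ^{s f(u)}` IS the integer power `u ↦ u^j`, torsion included — so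
  that the tree's INTEGER-power Tate theorem applies downstream, with `w = e(s) → 1` as `i → ∞`
  (`prime_pow_dvd_exp_sub_one`: `e(s) ≡ 1 mod p^{i+3}`).

No definition (the exponential into units is the term `e.toMonoidHom.toHomUnits`), no named fact,
no `sorry`.

References: Serre, *A Course in Arithmetic*, Ch. II §3.2, Prop. 8 (`U₁ ≅ ℤ_p` via `x ↦ (1+p)ˣ`);
[Washington1997] §5.1.
-/

noncomputable section

open Filter Topology

namespace Summit.BirchSwinnertonDyer.Rank1Residual.X11b.PadicExponentTwist

open Literature.NumberTheory.EllipticCurves.ZpExtension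

variable {p : ℕ} [Fact p.Prime]

section Exp

variable (e : AddChar ℤ_[p] ℤ_[p])

/-! ### §1 The exponential as a homomorphism into units -/

/-- `e(x)` as a unit: the value of `e.toMonoidHom.toHomUnits` at `x` is `e x`. [folklore] -/
theorem coe_expUnits_apply (x : Multiplicative ℤ_[p]) :
    ((e.toMonoidHom.toHomUnits x : ℤ_[p]ˣ) : ℤ_[p]) = e x.toAdd := rfl

/-- The inverse unit is `e(-x)`. [folklore] -/
theorem coe_inv_expUnits_apply (x : Multiplicative ℤ_[p]) :
    ((e.toMonoidHom.toHomUnits x)⁻¹ : ℤ_[p]ˣ) = e.toMonoidHom.toHomUnits x⁻¹ :=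
  (map_inv e.toMonoidHom.toHomUnits x).symm

variable {e} in
/-- The exponential into units is continuous when `e` is. [folklore] -/
theorem continuous_expUnits (he : Continuous e) : Continuous (e.toMonoidHom.toHomUnits) := by
  refine Units.continuous_iff.2 ⟨?_, ?_⟩
  · exact he.comp continuous_toAdd
  · have : (fun x : Multiplicative ℤ_[p] => ((e.toMonoidHom.toHomUnits x)⁻¹ : ℤ_[p]ˣ).val) =
        fun x => e (x⁻¹).toAdd := by
      funext x; rw [coe_inv_expUnits_apply]; rfl
    rw [this]
    exact he.comp (continuous_toAdd.comp continuous_inv)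

/-- A unit `v ≡ 1 (mod p³)` is in the image of the exponential: `v = e(x)` as units (tree
`PadicUnits.exists_addChar_eq`). [folklore] -/
theorem exists_expUnits_eq (he : Continuous e) (he1 : e 1 = 1 + (p : ℤ_[p]) ^ 3) {v : ℤ_[p]ˣ}
    (hv : (p : ℤ_[p]) ^ 3 ∣ (v : ℤ_[p]) - 1) :
    ∃ x : ℤ_[p], e.toMonoidHom.toHomUnits (Multiplicative.ofAdd x) = v := by
  obtain ⟨x, hx⟩ := PadicUnits.exists_addChar_eq e he he1 hv
  exact ⟨x, Units.ext (by rw [coe_expUnits_apply, toAdd_ofAdd, hx])⟩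

/-- `u ^ N`, `N = (p-1)p²`, is an exponential: `u ^ N = e(x)` for some `x` (tree
`PadicUnits.prime_pow_three_dvd_pow_sub_one`). [folklore] -/
theorem exists_expUnits_eq_pow (he : Continuous e) (he1 : e 1 = 1 + (p : ℤ_[p]) ^ 3) (u : ℤ_[p]ˣ) :
    ∃ x : ℤ_[p], e.toMonoidHom.toHomUnits (Multiplicative.ofAdd x) = u ^ ((p - 1) * p ^ 2) :=
  exists_expUnits_eq e he he1 (by rw [Units.val_pow_eq_pow_val]; exact PadicUnits.prime_pow_three_dvd_pow_sub_one u)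

/-! ### §2 `f ∘ e` is `ℤ_p`-linear -/

/-- **Linearity**: for a continuous `f : ℤ_pˣ →ₜ* ℤ_p` (written multiplicatively) and the
continuous exponential `e`, `f(e(x)) = f(e(1)) · x` for all `x ∈ ℤ_p`: both sides are continuous
additive functions of `x` agreeing on `ℕ`, which is dense in `ℤ_p`.
Ref: Serre, *A Course in Arithmetic*, Ch. II §3.2, Prop. 8. [folklore] -/
theorem toAdd_apply_expUnits_eq_mul (he : Continuous e) (f : ℤ_[p]ˣ →ₜ* Multiplicative ℤ_[p])
    (x : ℤ_[p]) :
    (f (e.toMonoidHom.toHomUnits (Multiplicative.ofAdd x))).toAdd =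
      (f (e.toMonoidHom.toHomUnits (Multiplicative.ofAdd 1))).toAdd * x := by
  -- the additive map `G x = f(e(x))`
  set G : ℤ_[p] →+ ℤ_[p] :=
    MonoidHom.toAdditive ((f : ℤ_[p]ˣ →* Multiplicative ℤ_[p]).comp e.toMonoidHom.toHomUnits) with hG
  have hG_apply : ∀ y, G y = (f (e.toMonoidHom.toHomUnits (Multiplicative.ofAdd y))).toAdd :=
    fun _ => rfl
  have hGc : Continuous G := by
    change Continuous fun y => (f (e.toMonoidHom.toHomUnits (Multiplicative.ofAdd y))).toAdd
    exact continuous_toAdd.comp (f.continuous.comp ((continuous_expUnits he).comp continuous_ofAdd))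
  -- agree on `ℕ`
  have hnat : ∀ n : ℕ, G n = G 1 * n := fun n => by
    rw [show (n : ℤ_[p]) = n • (1 : ℤ_[p]) by rw [nsmul_eq_mul, mul_one], map_nsmul, nsmul_eq_mul,
      mul_comm]
    simp
  have heq : (fun y => G y) = fun y => G 1 * y :=
    PadicInt.denseRange_natCast.equalizer hGc (continuous_const.mul continuous_id) (funext hnat)
  rw [← hG_apply, ← hG_apply, congrFun heq x]

/-! ### §3 `c = f(γ) ≠ 0` for non-trivial `f` -/

/-- **`f(γ) ≠ 0` when `f ≠ 1`.** If `f(e(1)) = 0` then `f ∘ e = 0` (linearity), so `f` kills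
`e(ℤ_p) = 1 + p³ℤ_p ∋ u^N` for every unit `u` (`N = (p-1)p²`), hence `N · f(u) = 0` and `f(u) = 0`
(`ℤ_p` is torsion-free): `f = 1`. [folklore] -/
theorem apply_expUnits_one_ne_one (he : Continuous e) (he1 : e 1 = 1 + (p : ℤ_[p]) ^ 3)
    (f : ℤ_[p]ˣ →ₜ* Multiplicative ℤ_[p]) (hf : ∃ u, f u ≠ 1) :
    (f (e.toMonoidHom.toHomUnits (Multiplicative.ofAdd 1))).toAdd ≠ 0 := by
  intro hc
  obtain ⟨u, hu⟩ := hf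
  apply hu
  have hp : p.Prime := Fact.out
  obtain ⟨x, hx⟩ := exists_expUnits_eq_pow e he he1 u
  -- `N • f u = f (u^N) = f (e x) = c x = 0`
  have h1 : ((p - 1) * p ^ 2) • (f u).toAdd = 0 := by
    rw [← toAdd_pow, ← map_pow, ← hx, toAdd_apply_expUnits_eq_mul e he f x, hc, zero_mul]
  rw [nsmul_eq_mul, mul_eq_zero] at h1
  rcases h1 with h | h
  · exfalso
    have hN : ((p - 1) * p ^ 2 : ℕ) ≠ 0 :=
      Nat.mul_ne_zero (Nat.sub_ne_zero_of_lt hp.one_lt) (pow_ne_zero _ hp.ne_zero)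
    exact hN (by exact_mod_cast h)
  · exact Multiplicative.toAdd.injective (by rw [h, toAdd_one])

/-! ### §4 The integer-power identity -/

/-- **The exponent twist is an INTEGER power.** Let `f : ℤ_pˣ →ₜ* ℤ_p` be continuous and
non-trivial. For every `i` there are `s ∈ ℤ_p`, `s ≠ 0`, `p^i ∣ s`, and `j ≥ 1` such that
`e(s · f(u)) = u ^ j` for every `u ∈ ℤ_pˣ`. (With `c = f(γ) = c₀ p^v`, `c₀` a unit: `s = N p^i c₀⁻¹`,
`j = N p^{i+v}`; indeed `N f(u) = f(u^N) = f(e(x_u)) = c x_u` where `e(x_u) = u^N`, so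
`s f(u) = p^{i+v} x_u` and `e(s f(u)) = e(x_u)^{p^{i+v}} = u^{N p^{i+v}}`.)
Ref: Serre, *A Course in Arithmetic*, Ch. II §3.2. [folklore] -/
theorem exists_exp_mul_apply_eq_pow (he : Continuous e) (he1 : e 1 = 1 + (p : ℤ_[p]) ^ 3)
    (f : ℤ_[p]ˣ →ₜ* Multiplicative ℤ_[p]) (hf : ∃ u, f u ≠ 1) (i : ℕ) :
    ∃ (s : ℤ_[p]) (j : ℕ), s ≠ 0 ∧ (p : ℤ_[p]) ^ i ∣ s ∧ 0 < j ∧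
      ∀ u : ℤ_[p]ˣ, e (s * (f u).toAdd) = (u : ℤ_[p]) ^ j := by
  have hp : p.Prime := Fact.out
  set c : ℤ_[p] := (f (e.toMonoidHom.toHomUnits (Multiplicative.ofAdd 1))).toAdd with hc_def
  have hc : c ≠ 0 := apply_expUnits_one_ne_one e he he1 f hf
  set c₀ : ℤ_[p]ˣ := PadicInt.unitCoeff hc with hc₀
  set v : ℕ := c.valuation with hv
  have hcv : c = (c₀ : ℤ_[p]) * (p : ℤ_[p]) ^ v := PadicInt.unitCoeff_spec hc
  set N : ℕ := (p - 1) * p ^ 2 with hN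
  have hN0 : N ≠ 0 := Nat.mul_ne_zero (Nat.sub_ne_zero_of_lt hp.one_lt) (pow_ne_zero _ hp.ne_zero)
  have hp0 : (p : ℤ_[p]) ≠ 0 := Nat.cast_ne_zero.2 hp.ne_zero
  refine ⟨(N : ℤ_[p]) * (p : ℤ_[p]) ^ i * ((c₀⁻¹ : ℤ_[p]ˣ) : ℤ_[p]), N * p ^ (i + v), ?_,
    ⟨(N : ℤ_[p]) * ((c₀⁻¹ : ℤ_[p]ˣ) : ℤ_[p]), by ring⟩,
    Nat.mul_pos (Nat.pos_of_ne_zero hN0) (pow_pos hp.pos _), fun u => ?_⟩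
  · exact mul_ne_zero (mul_ne_zero (Nat.cast_ne_zero.2 hN0) (pow_ne_zero _ hp0)) (Units.ne_zero _)
  · obtain ⟨x, hx⟩ := exists_expUnits_eq_pow e he he1 u
    -- `N f(u) = c x`
    have h1 : (N : ℤ_[p]) * (f u).toAdd = c * x := by
      rw [← nsmul_eq_mul, ← toAdd_pow, ← map_pow, ← hx, toAdd_apply_expUnits_eq_mul e he f x]
    -- `s f(u) = p^{i+v} x`
    have h2 : (N : ℤ_[p]) * (p : ℤ_[p]) ^ i * ((c₀⁻¹ : ℤ_[p]ˣ) : ℤ_[p]) * (f u).toAdd =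
        ((p ^ (i + v) : ℕ) : ℤ_[p]) * x := by
      calc (N : ℤ_[p]) * (p : ℤ_[p]) ^ i * ((c₀⁻¹ : ℤ_[p]ˣ) : ℤ_[p]) * (f u).toAdd
          = (p : ℤ_[p]) ^ i * ((c₀⁻¹ : ℤ_[p]ˣ) : ℤ_[p]) * ((N : ℤ_[p]) * (f u).toAdd) := by ring
        _ = (p : ℤ_[p]) ^ i * ((c₀⁻¹ : ℤ_[p]ˣ) : ℤ_[p]) * ((c₀ : ℤ_[p]) * (p : ℤ_[p]) ^ v * x) := by
              rw [h1, hcv]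
        _ = ((c₀⁻¹ : ℤ_[p]ˣ) : ℤ_[p]) * (c₀ : ℤ_[p]) * ((p : ℤ_[p]) ^ (i + v) * x) := by ring
        _ = ((p ^ (i + v) : ℕ) : ℤ_[p]) * x := by rw [Units.inv_mul, one_mul, Nat.cast_pow]
    -- `e(p^{i+v} x) = e(x)^{p^{i+v}} = (u^N)^{p^{i+v}}`
    have hx' : e x = ((u : ℤ_[p]) ^ N) := by
      have := congrArg (fun w : ℤ_[p]ˣ => (w : ℤ_[p])) hx
      simpa only [coe_expUnits_apply, toAdd_ofAdd, Units.val_pow_eq_pow_val] using this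
    rw [h2, ← nsmul_eq_mul, AddChar.map_nsmul_eq_pow, hx', ← pow_mul]

/-- **`e(s) → 1`**: if `p^i ∣ s` then `p^{i+3} ∣ e(s) - 1` (`e(s) = e(t)^{p^i}` with
`e(t) ≡ 1 mod p³`; tree `PadicUnits.addChar_sub_one_dvd`, `PadicUnits.pow_prime_pow_sub_one_dvd`).
[folklore] -/
theorem prime_pow_dvd_exp_sub_one (he : Continuous e) (he1 : e 1 = 1 + (p : ℤ_[p]) ^ 3)
    {s : ℤ_[p]} {i : ℕ} (hs : (p : ℤ_[p]) ^ i ∣ s) : (p : ℤ_[p]) ^ (3 + i) ∣ e s - 1 := by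
  obtain ⟨t, rfl⟩ := hs
  have h1 : (p : ℤ_[p]) ^ 3 ∣ e t - 1 := PadicUnits.addChar_sub_one_dvd e he he1 t
  have h2 := PadicUnits.pow_prime_pow_sub_one_dvd (p := p) (k := 3) three_ne_zero h1 i
  rw [← AddChar.map_nsmul_eq_pow, nsmul_eq_mul] at h2
  exact_mod_cast h2

end Exp

end Summit.BirchSwinnertonDyer.Rank1Residual.X11b.PadicExponentTwist

end
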